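import Summits.QuantumFields.YangMills.Theorems.TwistedTraceScaling.Negative.CentralEuclideanRadiusWindow
import HarnessLib

/-!
# Negative lemma R49 (cdisprove g41) — the window of the DECOUPLED relative-local (C1) glue
# (crux `TwistedTraceScaling` stmt-QuantumFields-20203, skeleton «twolattice»; vets `…BOCentralGlueInner` = p696042:
# `central_transfer_two_sided_of_localisedAvg_inner`, lane A g18, COARSE-DESIGN §28.6)

The decoupled glue keeps ONE sup scale `T` and the support radius `R` of `supp Ω∘linkEmbed`, but evaluates the central Gaussian at the INNER radius `R_in`
(`‖linkEmbed v′‖ ≤ R_in ≤ R`; factors `e^{±882βT²R_in²}`, `e^{49βR_in²}`, locality `6T²R_in ≤ R₀`).  Two certified facts bear on it verbatim: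
* the Euclidean single-link zero of `A_W(χ₀⊗Ω)` (`R47.smearedBO_singleLink_eq_zero`, packaged as `R47W.not_hAloAt_singleLink` with a free centre radius `R′`): the `hAlo` ball
  `{Σ_a w_e a² ≤ ρ²} ∩ {‖chartVec w − linkEmbed v′‖ ≤ R₀}` contains the zero `P(b·e₀⊗δ)` as soon as `48R + 400T² < 7b`, `b ≤ ρ`, `b + R_in ≤ R₀` (§1 `not_hAloInner_glue_euclid`);
* the lower constant of the glue is `≤ 0` unless `min(ρ−2T, R₀−6T²R_in)²β > |E×3|·log 2 + 98βR_in²` (`R46L.central_gaussian_tube_lower_local_nonpos`, whose `R` is exactly the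
  radius in the Gaussian factors — here `R_in`).
§2 `window_inner` (pure arithmetic) and §3 ★★★ `window_inner_of_hAlo` (from the glue's hypotheses VERBATIM, `gm > 0`, informative): then
  (a) `R₀ > 9.8·R_in`;  (b) `R₀²β > 9L³·log 2` and `ρ²β > 9L³·log 2` (`R₀, ρ > 2.497·L^{3/2}·β^{-1/2}`);  (c) `(48R + 400T²)²β > 39·9L³·log 2`, i.e. `R + 8.34T² > 0.325·L^{3/2}·β^{-1/2}`.
§4 with the COVERING inequality `R₀ + R_in ≤ R` (needed if `hAlo` on the ball around EVERY inner-core centre is to come from the supplier `…BOLocalisedAvgChartLower.localisedAvg_chart_lower`,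
stated for `‖chartVec w‖ ≤ R_w` with `hrf : R_w + … ≤ r_f = R`): `R_in < R/10.8` and `R²β > 9L³·log 2` (`window_inner_covering`); lane A's announced numbers (INBOX 2026-08-29 05:10Z,
docstring of p696042: `R_in = r_f/12`, `R₀ = 0.83·r_f`, `ℓ := r_f√β`) sit AT THE EDGE `0.83 ≈ √98/12 = 0.825`: informative needs `0.0083·ℓ² > 9L³log 2`, i.e. `ℓ > 27.3·L^{3/2}`
(`example`); the best covering choice `R₀ = r_f − R_in` needs `ℓ > 6.25·L^{3/2}` (`example`); `R_in = r_f/3` (the "relative-tail" reading of COARSE-DESIGN §28.6) is EXCLUDED by (a)+covering.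
READING (a constraint on the unbuilt (C1)/(C4) assembly; nothing landed is wrong): unlike the one-radius glue (R47W: `T > 0.09L^{3/4}β^{-1/4}`, dead), the decoupled glue IS
instantiable on schedule B — all it forces is VOLUME-DEPENDENT: profile radius `r_f > 2.5·L^{3/2}β^{-1/2}` (`> 6.25·L^{3/2}β^{-1/2}` at `R_in = r_f/12`), inner core `< r_f/10.8`, and
`R_Ω + 8.34T² > 0.325L^{3/2}β^{-1/2}`; with `ℓ = btLog → ∞` these are fixed-`L` thresholds in `β` (S-BASE's `β₁` may depend on `L`): NO KILL.  The same `L^{3/2}` floor appeared for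
CAPTURE (R40–R42: the stiff profile's mass lives at `‖x‖ ≍ L^{3/2}β^{-1/2}`, which the inner core must contain for (C4)) — so `R_in ≍ L^{3/2}β^{-1/2}` AND `R_in < r_f/10.8`: `ℓ ≳ 10.8·c_q·L^{3/2}`.
HONEST FRAMING: negative/boundary lemmas (helper, `--supports stmt-QuantumFields-20203`) about hypotheses of a brick of a stub of a child of the CONDITIONAL reduction route R2b1;
nothing here refutes or proves `TwistedTraceScaling`, S-BASE, (B-OD) or C4-CORE; not infinite volume, not a gap, not Clay. bears_on R2b1.
-/

set_option autoImplicit false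

noncomputable section

open MeasureTheory Filter Topology Real
open scoped BigOperators RealInnerProductSpace Quaternion
open Literature.MathematicalPhysics.QuantumFieldTheory hiding SU2
open Literature.MathematicalPhysics.QuantumLattice

namespace Summit.QuantumFields.YangMills.Theorems.TwistedTraceScaling.Negative.R49

open Summit.QuantumFields.YangMills.Theorems.FemtoTransferGap
open Summit.QuantumFields.YangMills.Theorems.FemtoTransferGap.TwoLattice
open Summit.QuantumFields.YangMills.Theorems.FemtoTransferGap.TwoLattice.Avg
open Summit.QuantumFields.YangMills.Theorems.FemtoTransferGap.TwoLattice.ConstTube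
open Summit.QuantumFields.YangMills.Theorems.FemtoTransferGap.TwoLattice.Stiff
open Summit.QuantumFields.YangMills.Theorems.FemtoTransferGap.TwoLattice.GnChart
open Summit.QuantumFields.YangMills.Theorems.TwistedTraceScaling.Negative.R46
open Summit.QuantumFields.YangMills.Theorems.TwistedTraceScaling.Negative.R46L
open Summit.QuantumFields.YangMills.Theorems.TwistedTraceScaling.Negative.R47
open Summit.QuantumFields.YangMills.Theorems.TwistedTraceScaling.Negative.R47W
open Literature.MathematicalPhysics.QuantumFieldTheory.Balaban1983to89.T4HaarSU2Translate renaming su2Quat_mul → su2Quat_mul₄, su2Quat_one → su2Quat_one₄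

variable {L : ℕ} [NeZero L]

/-! ## §1 The Euclidean kill radius of the decoupled glue -/

/-- ★★ **In the parameters of `…BOCentralGlueInner.central_transfer_two_sided_of_localisedAvg_inner`** (bundled support hypotheses `hΩt`, `hWc` with ONE scale `T` and the
Euclidean radius `R ≥ 0` of `supp Ω∘linkEmbed`; a centre `v′` in the INNER core `‖linkEmbed v′‖ ≤ R_in`; chart radius `ρ ≤ 1/2`; `L ≥ 2`): its hypothesis `hAlo` is FALSE for
every `gm > 0` as soon as an amplitude `b` with `48R + 400T² < 7b`, `b ≤ ρ`, `b + R_in ≤ R₀` exists — i.e. as soon as `7·min(ρ, R₀ − R_in) > 48R + 400T²`: decoupling moves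
the centre term from `R` to `R_in`, the zero radius `(8/7)(6R + 50T²)` is unchanged (it is the SUPPORT radius that enters `R47.smearedBO_singleLink_eq_zero`). [folklore] -/
theorem not_hAloInner_glue_euclid {Ω : LinkSpace L → ℝ} {W : (Site 3 L → SU2) → ℝ} {T R Γ : ℝ} (hR0 : 0 ≤ R)
    (hΩt : ∀ v : Edge 3 L → Fin 3 → ℝ, Ω (linkEmbed L v) ≠ 0 → v ∈ capBalancedSet L ∧ (∀ (e : Edge 3 L) (c : Fin 3), |v e c| ≤ T) ∧ ‖linkEmbed L v‖ ≤ R)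
    (hWc : ∀ g : Site 3 L → SU2, W g ≠ 0 → (∀ x, ‖su2Quat (g x) - 1‖ ≤ T) ∧ ‖∑ x, vecPart (g x)‖ ≤ Γ)
    (χ₀ : GaugeConfig 3 1 SU2 → ℝ) (hL : 2 ≤ L) {v' : Edge 3 L → Fin 3 → ℝ} {Rin : ℝ} (hx' : ‖linkEmbed L v'‖ ≤ Rin)
    {ρ R₀ b : ℝ} (hρ2 : ρ ≤ 1 / 2) (hbρ : b ≤ ρ) (hbR₀ : b + Rin ≤ R₀) (hkill : 48 * R + 400 * T ^ 2 < 7 * b) {β gm : ℝ} (hgm : 0 < gm) :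
    ¬ ∀ w : Edge 3 L → Fin 3 → ℝ, (∀ e, ∑ a, w e a ^ 2 ≤ ρ ^ 2) → ‖chartVec w - linkEmbed L v'‖ ≤ R₀ →
        gm * Real.exp (-stiffGaussExp L (β / 2) β (chartVec w)) ≤
          ∫ g, W g * boFun L χ₀ Ω (gaugeTransform g⁻¹ (latPatternChart L (fun _ => false) w)) ∂gaugeMeasure L := by
  have hb0 : 0 ≤ b := by nlinarith [sq_nonneg T]
  have habs : |b| = b := abs_of_nonneg hb0
  refine not_hAloAt_singleLink (fun v hv => (hΩt v hv).2.1) (fun v hv => (hΩt v hv).2.2) (fun g hg => (hWc g hg).1) χ₀ (0 : Site 3 L) (k := 0) (l := 1)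
    (by decide) (R11.shift_ne_self hL 0 1) (b := b) (by rw [habs]; linarith) (by rw [habs]; nlinarith [sq_nonneg T]) (by nlinarith) hx' (by rw [habs]; exact hbR₀) hgm

/-! ## §2 The window of the decoupled glue (pure arithmetic) -/

/-- ★★★ **Window, decoupled form** (arithmetic in the parameters of `…central_transfer_two_sided_of_localisedAvg_inner`: `β > 0`, `T ≥ 0`, `8T ≤ ρ`, `R_in ≥ 0`, `6T²R_in ≤ R₀`).
If `hAlo` holds with some `gm > 0` at some inner-core centre — so the kill window of `not_hAloInner_glue_euclid` is empty: `7·min(ρ, R₀ − R_in) ≤ 48R + 400T²` — and the lower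
constant is informative — `min(ρ−2T, R₀−6T²R_in)²β > |E×3|·log 2 + 98βR_in²` (`R46L.central_gaussian_tube_lower_local_nonpos` read with its `R :=` the Gaussian radius `R_in`) —
then (a) `R₀ > 9.8·R_in`, (b) `R₀²β > 9L³log 2` and `ρ²β > 9L³log 2`, (c) `(48R + 400T²)²β > 39·9L³log 2` (so `R + 8.34T² > 0.325·L^{3/2}β^{-1/2}`).  Contrast R47W
(`window_euclid`, one radius): there the same two facts forced `T > 0.09L^{3/4}β^{-1/4}`; here nothing couples `T` upward — the decoupled glue is instantiable. [folklore] -/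
theorem window_inner {β T R Rin R₀ ρ : ℝ} (hβ : 0 < β) (hT0 : 0 ≤ T) (hTρ : 8 * T ≤ ρ) (hRin0 : 0 ≤ Rin) (hR₀ : 6 * T ^ 2 * Rin ≤ R₀)
    (hinfo : Fintype.card (Edge 3 L × Fin 3) * Real.log 2 + 98 * β * Rin ^ 2 < (min (ρ - 2 * T) (R₀ - 6 * T ^ 2 * Rin)) ^ 2 * β)
    (hAlo : 7 * min ρ (R₀ - Rin) ≤ 48 * R + 400 * T ^ 2) :
    49 / 5 * Rin < R₀ ∧ 9 * (L : ℝ) ^ 3 * Real.log 2 < R₀ ^ 2 * β ∧ 9 * (L : ℝ) ^ 3 * Real.log 2 < ρ ^ 2 * β ∧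
      39 * (9 * (L : ℝ) ^ 3 * Real.log 2) < (48 * R + 400 * T ^ 2) ^ 2 * β := by
  rw [card_mul_log_two (L := L)] at hinfo
  set m := min (ρ - 2 * T) (R₀ - 6 * T ^ 2 * Rin) with hm
  have hc0 : 0 ≤ 9 * (L : ℝ) ^ 3 * Real.log 2 := mul_nonneg (by positivity) (Real.log_nonneg one_le_two)
  have h1 : 0 ≤ ρ - 2 * T := by linarith
  have h6 : 0 ≤ 6 * T ^ 2 * Rin := by positivity
  have h2 : 0 ≤ R₀ - 6 * T ^ 2 * Rin := by linarith
  have hm0 : 0 ≤ m := le_min h1 h2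
  have hmρ : m ≤ ρ - 2 * T := min_le_left _ _
  have hmR : m ≤ R₀ - 6 * T ^ 2 * Rin := min_le_right _ _
  have h98β : 0 ≤ 98 * β * Rin ^ 2 := by positivity
  have hmβ : 9 * (L : ℝ) ^ 3 * Real.log 2 < m ^ 2 * β := by linarith
  -- `m² > 98·R_in²`, so `m > 9.8·R_in`
  have h98 : 98 * Rin ^ 2 < m ^ 2 := by
    by_contra h
    push Not at h
    have := mul_le_mul_of_nonneg_right h hβ.le
    nlinarith
  have h98' : 49 / 5 * Rin < m := lt_of_pow_lt_pow_left₀ 2 hm0 (by nlinarith [sq_nonneg Rin])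
  have hR₀m : m ≤ R₀ := by linarith
  have hρm : m ≤ ρ := by linarith
  refine ⟨by linarith, ?_, ?_, ?_⟩
  · have h := mul_le_mul_of_nonneg_right (pow_le_pow_left₀ hm0 hR₀m 2) hβ.le
    linarith
  · have h := mul_le_mul_of_nonneg_right (pow_le_pow_left₀ hm0 hρm 2) hβ.le
    linarith
  · -- `min(ρ, R₀ − R_in) ≥ (44/49)·m`, so `48R + 400T² ≥ (44/7)·m` and `(44/7)² = 1936/49 > 39`
    have hmin : 44 / 49 * m ≤ min ρ (R₀ - Rin) := le_min (by linarith) (by linarith)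
    have h7 : 44 / 7 * m ≤ 48 * R + 400 * T ^ 2 := by linarith
    have h7' := mul_le_mul_of_nonneg_right (pow_le_pow_left₀ (by positivity) h7 2) hβ.le
    nlinarith

/-! ## §3 ★★★ The window from the decoupled glue's hypotheses verbatim -/

/-- ★★★ **THE DECOUPLED GLUE'S WINDOW, from its hypotheses verbatim**: `hΩt`, `hWc` (one scale `T ≥ 0`, support radius `R`), a centre `v′` with `‖linkEmbed v′‖ ≤ R_in ≤ R`,
`ρ ≤ 1/2`, `8T ≤ ρ`, `6T²R_in ≤ R₀`, `β > 0`, `L ≥ 2`, and `hAlo` EXACTLY as stated in `…BOCentralGlueInner.central_transfer_two_sided_of_localisedAvg_inner` with a POSITIVE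
`gm`; if moreover the displayed lower constant is informative (`|E×3|·log 2 + 98βR_in² < min(ρ−2T, R₀−6T²R_in)²β`), then
(a) `R₀ > 9.8·R_in`; (b) `R₀²β > 9L³log 2`, `ρ²β > 9L³log 2`; (c) `(48R + 400T²)²β > 351·L³·log 2`.  In schedule-B letters (`R = r_f = β^{-1/2}ℓ`, `T = T_W = O(Lβ^{-1/2}ℓ²)`):
the hAlo radius and the chart radius exceed `2.497·L^{3/2}β^{-1/2}`, the profile radius satisfies `ℓ + O(L²ℓ⁴β^{-1/2}) > 0.325·L^{3/2}` — VOLUME-DEPENDENT thresholds only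
(NO KILL: S-BASE's `β₁(L)` may depend on `L`). [folklore] -/
theorem window_inner_of_hAlo {Ω : LinkSpace L → ℝ} {W : (Site 3 L → SU2) → ℝ} {T R Γ : ℝ}
    (hΩt : ∀ v : Edge 3 L → Fin 3 → ℝ, Ω (linkEmbed L v) ≠ 0 → v ∈ capBalancedSet L ∧ (∀ (e : Edge 3 L) (c : Fin 3), |v e c| ≤ T) ∧ ‖linkEmbed L v‖ ≤ R)
    (hWc : ∀ g : Site 3 L → SU2, W g ≠ 0 → (∀ x, ‖su2Quat (g x) - 1‖ ≤ T) ∧ ‖∑ x, vecPart (g x)‖ ≤ Γ)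
    (χ₀ : GaugeConfig 3 1 SU2 → ℝ) (hL : 2 ≤ L) {v' : Edge 3 L → Fin 3 → ℝ} {Rin : ℝ} (hx' : ‖linkEmbed L v'‖ ≤ Rin) (hRin : Rin ≤ R)
    {ρ R₀ : ℝ} (hρ2 : ρ ≤ 1 / 2) (hT0 : 0 ≤ T) (hTρ : 8 * T ≤ ρ) (hR₀ : 6 * T ^ 2 * Rin ≤ R₀)
    {β : ℝ} (hβ : 0 < β) {gm : ℝ} (hgm : 0 < gm)
    (hAlo : ∀ w : Edge 3 L → Fin 3 → ℝ, (∀ e, ∑ a, w e a ^ 2 ≤ ρ ^ 2) → ‖chartVec w - linkEmbed L v'‖ ≤ R₀ →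
        gm * Real.exp (-stiffGaussExp L (β / 2) β (chartVec w)) ≤
          ∫ g, W g * boFun L χ₀ Ω (gaugeTransform g⁻¹ (latPatternChart L (fun _ => false) w)) ∂gaugeMeasure L)
    (hinfo : Fintype.card (Edge 3 L × Fin 3) * Real.log 2 + 98 * β * Rin ^ 2 < (min (ρ - 2 * T) (R₀ - 6 * T ^ 2 * Rin)) ^ 2 * β) :
    49 / 5 * Rin < R₀ ∧ 9 * (L : ℝ) ^ 3 * Real.log 2 < R₀ ^ 2 * β ∧ 9 * (L : ℝ) ^ 3 * Real.log 2 < ρ ^ 2 * β ∧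
      39 * (9 * (L : ℝ) ^ 3 * Real.log 2) < (48 * R + 400 * T ^ 2) ^ 2 * β := by
  have hRin0 : 0 ≤ Rin := (norm_nonneg _).trans hx'
  have hR0 : 0 ≤ R := hRin0.trans hRin
  have hwin : 7 * min ρ (R₀ - Rin) ≤ 48 * R + 400 * T ^ 2 := by
    by_contra h
    push Not at h
    exact not_hAloInner_glue_euclid hR0 hΩt hWc χ₀ hL hx' hρ2 (min_le_left _ _) (by linarith [min_le_right ρ (R₀ - Rin)]) h hgm hAlo
  exact window_inner hβ hT0 hTρ hRin0 hR₀ hinfo hwin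

/-! ## §4 Reading with the covering inequality and lane A's announced numbers -/

omit [NeZero L] in
/-- ★★ **Covering.**  If the glue's `hAlo` ball around every inner-core centre (`‖linkEmbed v′‖ ≤ R_in`, radius `R₀`) is to be supplied from a statement on `‖chartVec w‖ ≤ R_w`
with `R_w ≤ R` (the supplier `…BOLocalisedAvgChartLower.localisedAvg_chart_lower`: `hcwR : ‖chartVec w‖ ≤ R_w`, `hrf : R_w + 14|E|ρ² + D′ + D ≤ r_f`, and `R = r_f` is the
support radius of the frozen profile), then `R₀ + R_in ≤ R`; with (a), (b) of `window_inner`: the inner core is `< R/10.8` (so `R_in = r_f/3` is excluded, `r_f/12` admissible)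
and the profile radius obeys `R²β > 9L³log 2`, `R > 2.497·L^{3/2}β^{-1/2}`. [folklore] -/
theorem window_inner_covering {β R Rin R₀ : ℝ} (hRin0 : 0 ≤ Rin) (ha : 49 / 5 * Rin < R₀) (hb : 9 * (L : ℝ) ^ 3 * Real.log 2 < R₀ ^ 2 * β) (hβ : 0 < β)
    (hcov : R₀ + Rin ≤ R) : 54 / 5 * Rin < R ∧ 9 * (L : ℝ) ^ 3 * Real.log 2 < R ^ 2 * β := by
  have hR₀0 : 0 ≤ R₀ := by linarith
  have hR₀R : R₀ ≤ R := by linarith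
  have h := mul_le_mul_of_nonneg_right (pow_le_pow_left₀ hR₀0 hR₀R 2) hβ.le
  exact ⟨by linarith, by linarith⟩

/-- Lane A's announced numbers (INBOX 2026-08-29 05:10Z; docstring of p696042): `R_in = r_f/12`, `R₀ = 0.83·r_f`.  Since `0.83² − 98/144 = 0.0083`, the informative
condition (b-form `9L³log 2 + 98βR_in² < R₀²β`, weaker than `hinfo`) needs `r_f²β > 747·L³`, i.e. `ℓ = r_f√β > 27.3·L^{3/2}` — not `ℓ ≫ 1`. [folklore] -/
example {β rf : ℝ} (h : 9 * (L : ℝ) ^ 3 * Real.log 2 + 98 * β * (rf / 12) ^ 2 < (83 / 100 * rf) ^ 2 * β) : 747 * (L : ℝ) ^ 3 < rf ^ 2 * β := by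
  have hlog := Real.log_two_gt_d9
  have hL3 : 0 ≤ (L : ℝ) ^ 3 := by positivity
  nlinarith [mul_le_mul_of_nonneg_left hlog.le hL3]

/-- The best covering choice at `R_in = r_f/12`: `R₀ ≤ r_f − R_in = (11/12)r_f`; then informative needs `(121−98)/144·r_f²β > 9L³log 2`, i.e. `r_f²β > 39·L³`, `ℓ > 6.25·L^{3/2}`.
[folklore] -/
example {β rf R₀ : ℝ} (hβ : 0 < β) (hR₀0 : 0 ≤ R₀) (hcov : R₀ ≤ 11 / 12 * rf) (h : 9 * (L : ℝ) ^ 3 * Real.log 2 + 98 * β * (rf / 12) ^ 2 < R₀ ^ 2 * β) :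
    39 * (L : ℝ) ^ 3 < rf ^ 2 * β := by
  have hlog := Real.log_two_gt_d9
  have hL3 : 0 ≤ (L : ℝ) ^ 3 := by positivity
  have h1 := mul_le_mul_of_nonneg_right (pow_le_pow_left₀ hR₀0 hcov 2) hβ.le
  nlinarith [mul_le_mul_of_nonneg_left hlog.le hL3]

/-- General inner fraction `R_in = r_f/k` under covering `R₀ ≤ r_f − R_in`: informative forces `(k−1)² > 98`, i.e. `k > 1 + √98 ≈ 10.9` — the inner core of the decoupled glue
is at most `r_f/10.9` whatever `β, L` (here: `k = 10` is impossible). [folklore] -/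
example {β rf R₀ : ℝ} (hβ : 0 < β) (hR₀0 : 0 ≤ R₀) (hcov : R₀ ≤ rf - rf / 10) :
    ¬ (9 * (L : ℝ) ^ 3 * Real.log 2 + 98 * β * (rf / 10) ^ 2 < R₀ ^ 2 * β) := by
  intro h
  have hc0 : 0 ≤ 9 * (L : ℝ) ^ 3 * Real.log 2 := mul_nonneg (by positivity) (Real.log_nonneg one_le_two)
  have h1 := mul_le_mul_of_nonneg_right (pow_le_pow_left₀ hR₀0 hcov 2) hβ.le
  nlinarith [sq_nonneg rf, mul_nonneg hβ.le (sq_nonneg rf)]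

end Summit.QuantumFields.YangMills.Theorems.TwistedTraceScaling.Negative.R49

end
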